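import Summits.Schanuel.Schanuel.Theses.RoyCriterion
import Summits.Schanuel.Schanuel.Theorems.RoySmallValueDirichletGap.Negative.GapReduction
import Summits.Schanuel.Schanuel.Theorems.RoySmallValueDirichletGap.Negative.EtaNeZeroFalse
import Summits.Schanuel.Schanuel.Theorems.RoySmallValueDirichletGap.Negative.TauLtOneAndCountLeDegreeFalse
import Summits.Schanuel.Schanuel.Theorems.RoySmallValueDirichletGap.Negative.DirichletEdge
import Summits.Schanuel.Schanuel.Theorems.RoySmallValueDirichletGap.Negative.FrequentlyFalse
import Literature.NumberTheory.Transcendental.RoySmallValueStep4Orbit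
import Literature.NumberTheory.Transcendental.RoySmallValueEndgame

/-!
# Line `upward-lethality-persistence` for crux `RoySmallValueDirichletGap` (item stmt-Schanuel-1050) — crux-plan verdict: NO CONCLUDING SKELETON

Crux (route `RoyCriterion`): `Summit.Schanuel.Schanuel.Theses.RoyCriterion.RoySmallValueDirichletGap`
= Roy 2013 (arXiv:1301.0663) Thm 1.1 with `ν` pushed down to the Dirichlet edge `2 + β − τ`
(open content, landed `…Gap.roySmallValueDirichletGap_iff_gap`: `1 < τ < 2`,
`0 < δ := ν − (2+β−τ) ≤ δ_R := (τ−1)(2−τ)/(β+1−τ)`, and WLOG `δ` as small as one likes,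
`…_iff_nearEdge`).

Idea `upward-lethality-persistence` (crux-ideate r2, ideator 5; triage r2-1 PASS-as-merge-only,
r2-2 PASS-as-merge-only, r2-3 FAIL): Roy's Step 4 (product formula on the enemy `Z_D` at an
integer form with `t` small `𝒟`-jets at `γ`) loses the factor `T/t` only when `t < T`; run at any
level `D' ≥ D` with `t ≥ T` it is LOSSLESS, so in a counterexample every small integer form of the
levels `[D, c·D^{1+δ/β}]` kills `Z_D` (upward containment `Z_D ⊂ W_{D'}`), the enemy absorbs
`(3 − o(1))⌊D'^τ⌋` derivatives on `(C·D^{1−δ/(τ−1)}, D]`, and the crux at the edge becomes the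
transfer BNP(Λ) = "no qualifying enemy persists over the level window `[D/Λ, ΛD]`".

## What this file certifies (lean check rc 0, NO `sorry`, no `stub_*`: nothing is registered)

* §1 THE LEVER IS ALREADY A TREE THEOREM (size S, not M). `upwardStep4_le_two_mul`: the tree's
  `Roy2013.ZeroConfigK.step45_combined` (RoySmallValueStep4Orbit.lean) is stated for an ARBITRARY
  integer form `R ∈ 𝒞(D_s, Y_s, U_s, T_s)` and an arbitrary count `T_s`, with loss factor
  `T/T_s + 1`; for `T ≤ T_s` that factor is `≤ 2` — this is the whole "lossless upward direction"
  (proved here in a few lines from the tree theorem; `levelTransfer_term/_mono` are the per-term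
  versions, proved). `upwardLethalEndgame_holds` (proved, real exponents): the resulting inequality
  `κD^δ(D^βg + Dh) ≤ A(λD)^βg + λDh + Cg` is impossible for large `D` for EVERY `δ > 0`, so an
  integer form of level `λD` with `≥ T` small jets not vanishing on `Z_D` cannot exist.
  `tcrit_lt_count_iff`: the card's consequence (c) "`3T' > t_crit(D')`" is literally Roy's first
  endgame inequality `(D*)^{τ−1} ≪ D^{τ−1−δ}` (`Roy2013.endgame_step`.1) — a non-novelty certificate.
  What remains of the structure statements (a) upward containment, (b) absorption order
  `3T' − t_crit`, (d) persistence window is WIRING: Step 1 at level `D'` (`𝒟ʲP̃_{D'} ∈ 𝒞_{D'}`)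
  + `upwardStep4_le_two_mul` + `upwardLethalEndgame_holds`, modulo the known L-size exposure of
  Roy's per-level data `(Z_D, 𝒰, D*)` from `RoySmallValueMain`'s `by_contra`
  (Lines/leaf-invariant-theta.md §Hardest stub). They are TRUE structure theorems of every
  counterexample — SUPPORT-grade for the merged structure line (head: `two-sided-absorption-transfer`,
  per all three triagers) — and they are REALISED at a transcendental point on bounded windows
  (r2-3's window witness: the landed `∃ᶠ` witness `(0, η∞)` of
  `…Frequently.roySmallValueDirichletGap_false_with_frequently` serves every level of
  `[0.693h, ≈h^{1.53}]`, `h = 2^{4ⁿ}`, with the single rational enemy `(0, s_n)` exactly and fully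
  absorbed and persisting over `[D^{0.78}, D^{1.22}] ⊋ [D/Λ, ΛD]`), so none of them can be the
  contradiction.
* §2 THE TRANSFER IS DEGENERATE (costume certificate, kernel-checked). Every statement of the shape
  "in every counterexample `(ξ,η,β,τ,ν)` to the crux, `Φ`" (`InEveryCounterexample Φ`) FOLLOWS from
  the crux for every `Φ` (`inEveryCounterexample_of_crux`), and IMPLIES the crux as soon as
  "in every counterexample, `¬Φ`" is a theorem (`crux_of_inEveryCounterexample`); the crux itself is
  the case `Φ = False` (`crux_iff_inEveryCounterexample_false`). BNP(Λ) is
  `InEveryCounterexample (NonPersistence Λ)` (typed below: `BNP`, with the hypothesis SEQUENCE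
  `IsHypSeq`, exact `𝒟₁`-flatness `FlatAt`, the window predicate `PersistsOn`, and Roy's qualifying
  condition left as an abstract parameter `Qual` — the degeneracy does not depend on it), and the
  card's own structure lemma (a)+(b)+(d) is `InEveryCounterexample (Persistence Λ)`
  (`PersistenceLemma`); hence `crux_of_bnp : PersistenceLemma → BNP → crux` and
  `bnp_of_crux : crux → BNP` — BNP is the crux plus a free lemma, exactly as r2-1/r2-2 said, and a
  skeleton `stub_persistence → stub_BNP → RoySmallValueDirichletGap` would be a COSTUME
  (its last stub is the crux restricted to a class containing all counterexamples).
* The closing tool the card names instead (companion card `leaf-jensen-crowding`) FAILED triage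
  2/3: it needs `≳ D^{τδ/(τ−1)}` distinct enemies co-alive at `D*` in distinct dyadic shells, while
  the sole-server epoch configuration (one enemy serving `[E, E^{bs}]`, `bs > 1 ⟺ δ < δ_R`,
  r2-1 `epoch_tight_iff`) — consistent with Steps 1–5, with two-sided absorption and with the
  total-closeness ledger — has `O(1)` enemies alive at every level.
* NEW REMARK (this seat): the one configuration the upward range could have fed to a pair/crowd
  lever — two distinct QUALIFYING enemies at the SAME level — already follows from Roy's DOWNWARD
  absorption: at the last level `D^top` at which `Z` qualifies (mortality: a fixed `Z` has
  `M_Z(D) = O(D^τ) < D^{β+δ}`), the enemy `Z'` selected at `D^top + 1` is distinct from `Z`, has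
  `D*(Z') ≤ C (D^top)^{1−δ/(τ−1)} < D^top`, hence `Z' ⊂ W_{D^top}` by Roy's own Step 3/4 range, and
  qualifies at `D^top` up to the factor `⌊(D^top)^τ⌋/⌊(D^top+1)^τ⌋ → 1`. So the upward lever adds
  NO configuration beyond Roy's; and same-level pairs are exactly the round-1 levers, dead at the
  budget wall (`τ < 3/2` generic enemies, BarrierNotesIdeator5 B1; measures `τ < 7/4`,
  Lines/coset-difference-hermite-lindemann.md).

Disproof.lean (tree, gen2) honoured / used: `crux_iff_gapCase`, `crux_iff_nearEdge` (landed
`…Gap.*`, imported: why the card's deliverable is a level window and not a ν-window — and §2 shows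
the level window is no better); `crux_false_without_etaNeZero` (landed, imported; `η ≠ 0` enters
`upwardStep4_le_two_mul` through `adist`/`roy_c4` exactly as in Roy's Prop 4.2/4.5);
`crux_false_without_oneLeTau`, `…_of_count_le_degree` (landed `…TauCount.*`, imported; `t_crit <
3T'` needs `τ > 1` and the full count, `tcrit_lt_count_iff`); §4 `dirichletEdge` (landed
`…Dirichlet.*`, imported; every inequality of §1 carries `D^δ`, `δ > 0`: `upwardLethalEndgame_holds`
needs `0 < δ`); §6 `not_cruxFrequently` (landed `…Frequently.*`, imported; it is the ENGINE of the
window witness that kills BNP's why-easier). No statement in this file is an instance of a landed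
Negative lemma; nothing goes below the Dirichlet edge.

NOT registered with `ledger skeleton check` on purpose (same policy as Lines/leaf-invariant-theta.lean):
nothing here concludes the crux except the degenerate transfer, and registering `stub_*` on the crux
item would constrain `propose --supports stmt-Schanuel-1050` for every other seat.
-/

set_option linter.dupNamespace false
set_option linter.unusedVariables false

noncomputable section

namespace Summit.Schanuel.Schanuel.Cruxes.RoySmallValueDirichletGap.UpwardLethalityPersistence

open Filter Complex MvPolynomial Finset Height
open Literature.NumberTheory.Transcendental
open Literature.NumberTheory.Transcendental.Roy2013
open Summit.Schanuel.Schanuel.Theses.RoyCriterion (RoySmallValueDirichletGap)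

/-! ## §0 The crux read back -/

/-- The small-value hypothesis of the crux at `(ξ, η)` with exponents `(β, τ, ν)` — the verbatim
sub-formula of `RoySmallValueDirichletGap` (= `Disproof.SmallValueHyp`). [cite: Roy2013, Theorem 1.1 (hypothesis)] -/
def SmallValueHyp (ξ η : ℂ) (β τ ν : ℝ) : Prop :=
  ∀ᶠ D : ℕ in atTop, ∃ P : MvPolynomial (Fin 2) ℤ, P ≠ 0 ∧ P.totalDegree ≤ D ∧
    (mvPolyHeight P : ℝ) ≤ Real.exp ((D : ℝ) ^ β) ∧
    ∀ i : ℕ, i < 3 * ⌊(D : ℝ) ^ τ⌋₊ →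
      ‖MvPolynomial.aeval ![ξ, η] (royD^[i] P)‖ ≤ Real.exp (-(D : ℝ) ^ ν)

/-- READ-BACK: the crux verbatim in terms of `SmallValueHyp`. -/
theorem crux_iff : RoySmallValueDirichletGap ↔
    ∀ (ξ η : ℂ), η ≠ 0 → ∀ (β τ ν : ℝ), 1 ≤ τ → τ < 2 → τ < β → 2 + β - τ < ν →
      SmallValueHyp ξ η β τ ν → IsAlgebraic ℚ ξ ∧ IsAlgebraic ℚ η := Iff.rfl

/-- Roy's correction term `δ_R = (τ−1)(2−τ)/(β+1−τ)` (width of the open window).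
[cite: Roy2013, Theorem 1.1, (1.1)] -/
def royGap (β τ : ℝ) : ℝ := (τ - 1) * (2 - τ) / (β + 1 - τ)

/-- `δ_R > 0` exactly on the open range `1 < τ < 2`, `β > τ`. -/
theorem royGap_pos {β τ : ℝ} (h1 : 1 < τ) (h2 : τ < 2) (hβ : τ < β) : 0 < royGap β τ :=
  div_pos (mul_pos (by linarith) (by linarith)) (by linarith)

/-! ## §1 The lever: lossless upward level transfer — already in tree -/

/-- **Level transfer of one closeness term** (card, First lemma (i)). With `ld = log dist(α,(1:γ)) ≤ 0`
and `le = log dist(α, A_γ)`, for `0 ≤ t ≤ T`: `max (t·ld) le ≤ (t/T)·max (T·ld) le + max le 0`.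
Read downward (`t = T* < T`) this is Roy's Step-5 loss `T/T*`. [cite: Roy2013, §7, Step 5] -/
theorem levelTransfer_term {t T ld le : ℝ} (ht : 0 ≤ t) (htT : t ≤ T) (hT : 0 < T)
    (hld : ld ≤ 0) :
    max (t * ld) le ≤ t / T * max (T * ld) le + max le 0 := by
  have hq0 : 0 ≤ t / T := div_nonneg ht hT.le
  have hq1 : t / T ≤ 1 := (div_le_one hT).2 htT
  have hm1 : T * ld ≤ max (T * ld) le := le_max_left _ _
  have hm2 : le ≤ max (T * ld) le := le_max_right _ _
  have h0 : 0 ≤ max le 0 := le_max_right _ _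
  have hle : le ≤ max le 0 := le_max_left _ _
  rcases le_total le (t * ld) with h | h
  · rw [max_eq_left h]
    have : t * ld = t / T * (T * ld) := by field_simp
    nlinarith [mul_le_mul_of_nonneg_left hm1 hq0]
  · rw [max_eq_right h]
    rcases le_total le 0 with hle0 | hle0
    · have h1 : t / T * le ≥ le := by nlinarith
      nlinarith [mul_le_mul_of_nonneg_left hm2 hq0]
    · have h2 : 0 ≤ t / T * max (T * ld) le :=
        mul_nonneg hq0 (le_trans hle0 hm2)
      linarith

/-- **The upward direction is free**: for `T ≤ t` and `ld ≤ 0`, `max (t·ld) le ≤ max (T·ld) le`.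
[cite: Roy2013, §7, Step 5 (monotonicity in the count)] -/
theorem levelTransfer_mono {t T ld le : ℝ} (hTt : T ≤ t) (hld : ld ≤ 0) :
    max (t * ld) le ≤ max (T * ld) le :=
  max_le_max (by nlinarith) le_rfl

/-- **Upward Step 4 = the tree's `step45_combined` with `T ≤ T_s`.** For Roy's configuration `Z`
(orbit `O = orb i₀`), ANY integer form `R` of ANY degree `D_s` in Roy's body
`𝒞(D_s; Y_s, U_s, T_s)` that does not vanish on `O`, and ANY count `T_s ≥ T`, the Step-2 mass
`Λ₂` of the orbit at count `T` is at most TWICE the product-formula bound of level `D_s`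
(`D_s·h(O) + #O·(D_s log 3 + Y_s) + #O·log(4·3^{D_s}e^{Y_s}c₄^{D_s})`): no factor `(D/D_s)^τ`.
This is the card's lever ("run Step 4 ABOVE the construction level, lossless") as a COROLLARY of the
tree theorem — size S. [cite: Roy2013, §7, Steps 4–5 (with `(D*,T*,P*) ↦ (D_s ≥ D, T_s ≥ T, R)`)] -/
theorem upwardStep4_le_two_mul {K : IntermediateField ℚ ℂ} {ι : Type*} [Fintype ι] [DecidableEq ι]
    (Z : ZeroConfigK K ι) [Normal ℚ K] [NumberField K]
    (i₀ : ι) {ξ η : ℂ} {T Ds Ts : ℕ} {Ys Us Λ₂ : ℝ}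
    {R : MvPolynomial (Fin 3) ℤ} (hR : R.IsHomogeneous Ds)
    (hRmem : map (Int.castRingHom ℂ) R ∈ royBody Ds ξ η Ys Us Ts)
    (hRne : ∃ j ∈ Z.orb i₀, aeval (Z.α j) (map (Int.castRingHom ℂ) R) ≠ 0)
    (hTTs : T ≤ Ts) (hTs : 0 < Ts) (hYs : 0 ≤ Ds * Real.log 3 + Ys)
    (hd₁ : ∀ j ∈ Z.orb i₀, 0 < pdist ξ η (supNormalise (Z.α j)))
    (hbig : Real.log 2 + 2 * roy_c2 ξ η ^ 2 - Us <
      -(Ds * ((∑ j ∈ Z.orb i₀, logHeight (Z.rep j)) / Module.finrank ℚ K) +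
        (Z.orb i₀).card * (Ds * Real.log 3 + Ys)))
    (h2 : ∑ j ∈ (Z.orb i₀).filter (fun j => pdist ξ η (supNormalise (Z.α j)) ≤ (2 * roy_c2 ξ η)⁻¹),
        max (T * Real.log (pdist ξ η (supNormalise (Z.α j))))
          (if 0 < adist ξ η (supNormalise (Z.α j)) then Real.log (adist ξ η (supNormalise (Z.α j)))
            else T * Real.log (pdist ξ η (supNormalise (Z.α j)))) ≤ -Λ₂) :
    Λ₂ ≤ 2 * (Ds * ((∑ j ∈ Z.orb i₀, logHeight (Z.rep j)) / Module.finrank ℚ K) +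
        (Z.orb i₀).card * (Ds * Real.log 3 + Ys) +
        (Z.orb i₀).card * Real.log (4 * (3 ^ Ds * Real.exp Ys * roy_c4 ξ η ^ Ds))) := by
  have h45 := Z.step45_combined i₀ hR hRmem hRne hTs hYs hd₁ hbig h2
  -- the log of the Step-4 constant is non-negative (as inside `step45_combined`)
  have hc4 := roy_c4_pos ξ η
  have hlog4 : 0 ≤ Real.log (4 * (3 ^ Ds * Real.exp Ys * roy_c4 ξ η ^ Ds)) := by
    refine Real.log_nonneg ?_
    have h1 : (1 : ℝ) ≤ 3 ^ Ds * Real.exp Ys * roy_c4 ξ η ^ Ds := by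
      have hY1 : Real.exp (-(Ds * Real.log 3)) ≤ Real.exp Ys := Real.exp_le_exp.mpr (by linarith)
      have h3 : Real.exp (-(Ds * Real.log 3)) * 3 ^ Ds = 1 := by
        rw [← Real.rpow_natCast, ← Real.exp_log (by norm_num : (0 : ℝ) < 3), ← Real.exp_mul,
          Real.log_exp, ← Real.exp_add]; simp [mul_comm]
      have hc4D : (1 : ℝ) ≤ roy_c4 ξ η ^ Ds := one_le_pow₀ (by
        have := one_le_roy_c2 ξ η
        rw [roy_c4, roy_A]; nlinarith [Real.add_one_le_exp (2 * roy_c2 ξ η ^ 2), Real.exp_pos (roy_c2 ξ η)])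
      calc (1 : ℝ) = Real.exp (-(Ds * Real.log 3)) * 3 ^ Ds * 1 := by rw [h3, one_mul]
        _ ≤ Real.exp Ys * 3 ^ Ds * roy_c4 ξ η ^ Ds := by gcongr
        _ = 3 ^ Ds * Real.exp Ys * roy_c4 ξ η ^ Ds := by ring
    linarith
  have hX : 0 ≤ Ds * ((∑ j ∈ Z.orb i₀, logHeight (Z.rep j)) / Module.finrank ℚ K) +
      (Z.orb i₀).card * (Ds * Real.log 3 + Ys) +
      (Z.orb i₀).card * Real.log (4 * (3 ^ Ds * Real.exp Ys * roy_c4 ξ η ^ Ds)) := by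
    have t1 : 0 ≤ (Ds : ℝ) * ((∑ j ∈ Z.orb i₀, logHeight (Z.rep j)) / Module.finrank ℚ K) :=
      mul_nonneg (Nat.cast_nonneg _)
        (div_nonneg (Finset.sum_nonneg fun j _ => logHeight_nonneg _) (Nat.cast_nonneg _))
    have t2 : 0 ≤ ((Z.orb i₀).card : ℝ) * (Ds * Real.log 3 + Ys) := mul_nonneg (Nat.cast_nonneg _) hYs
    have t3 : 0 ≤ ((Z.orb i₀).card : ℝ) * Real.log (4 * (3 ^ Ds * Real.exp Ys * roy_c4 ξ η ^ Ds)) :=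
      mul_nonneg (Nat.cast_nonneg _) hlog4
    linarith
  have hratio : (T : ℝ) / Ts + 1 ≤ 2 := by
    have hTs' : (0 : ℝ) < Ts := by exact_mod_cast hTs
    have : (T : ℝ) / Ts ≤ 1 := by
      rw [div_le_one hTs']; exact_mod_cast hTTs
    linarith
  exact h45.trans (mul_le_mul_of_nonneg_right hratio hX)

/-- **Upward lethal endgame (real-exponent form; card, First lemma (ii)).** Roy's Step 2 at level `D`
gives `κ D^δ (D^β g + D h) ≤ Λ₂`; `upwardStep4_le_two_mul` at level `D_s = λD ≥ D` with a
non-vanishing integer form having `≥ T` small jets gives `Λ₂ ≤ A (λD)^β g + λ D h + C g`. The two are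
incompatible for large `D`, for EVERY `δ > 0`. [cite: Roy2013, §7, Step 5 (upward variant)] -/
def UpwardLethalEndgame : Prop :=
  ∀ (β δ κ A C lam : ℝ), 1 ≤ β → 0 < δ → 0 < κ → 0 < A → 0 ≤ C → 1 ≤ lam →
    ∀ᶠ D : ℝ in atTop, ∀ g h : ℝ, 1 ≤ g → 0 ≤ h →
      ¬ (κ * D ^ δ * (D ^ β * g + D * h) ≤ A * (lam * D) ^ β * g + lam * D * h + C * g)

/-- `UpwardLethalEndgame` holds (elementary; proof from the ideator's Sketch, re-checked here). -/
theorem upwardLethalEndgame_holds : UpwardLethalEndgame := by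
  intro β δ κ A C lam hβ hδ hκ hA hC hlam
  have hK := ((tendsto_rpow_atTop hδ).eventually_ge_atTop
    (2 * (A * lam ^ β + C + lam) / κ)).and (eventually_ge_atTop (1 : ℝ))
  filter_upwards [hK] with D hD g h hg hh hle
  obtain ⟨hKD, hD1⟩ := hD
  have hDpos : 0 < D := by linarith
  have hlam0 : 0 ≤ lam := by linarith
  have hDβ : 0 < D ^ β := Real.rpow_pos_of_pos hDpos β
  have hDβ1 : 1 ≤ D ^ β := Real.one_le_rpow hD1 (by linarith)
  have hlamβ : 0 ≤ lam ^ β := Real.rpow_nonneg hlam0 β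
  have hmul : (lam * D) ^ β = lam ^ β * D ^ β := Real.mul_rpow hlam0 hDpos.le
  have hκD : 2 * (A * lam ^ β + C + lam) ≤ κ * D ^ δ := by
    have := mul_le_mul_of_nonneg_left hKD hκ.le
    rwa [mul_div_cancel₀ _ hκ.ne'] at this
  set X : ℝ := D ^ β * g + D * h with hX
  have hg0 : 0 ≤ g := by linarith
  have hXpos : 0 < X := by
    have : 0 < D ^ β * g := mul_pos hDβ (by linarith)
    have : 0 ≤ D * h := mul_nonneg hDpos.le hh
    linarith
  have hDgX : D ^ β * g ≤ X := by have : 0 ≤ D * h := mul_nonneg hDpos.le hh; linarith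
  have hDhX : D * h ≤ X := by have : 0 ≤ D ^ β * g := mul_nonneg hDβ.le hg0; linarith
  have hgX : g ≤ X := by
    have : g ≤ D ^ β * g := by nlinarith
    linarith
  have hR : A * (lam * D) ^ β * g + lam * D * h + C * g ≤ (A * lam ^ β + C + lam) * X := by
    rw [hmul]
    have h1 : A * (lam ^ β * D ^ β) * g = (A * lam ^ β) * (D ^ β * g) := by ring
    rw [h1]
    have e1 : (A * lam ^ β) * (D ^ β * g) ≤ (A * lam ^ β) * X :=
      mul_le_mul_of_nonneg_left hDgX (mul_nonneg hA.le hlamβ)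
    have e2 : lam * D * h ≤ lam * X := by
      rw [mul_assoc]; exact mul_le_mul_of_nonneg_left hDhX hlam0
    have e3 : C * g ≤ C * X := mul_le_mul_of_nonneg_left hgX hC
    nlinarith
  have hL : 2 * (A * lam ^ β + C + lam) * X ≤ κ * D ^ δ * X :=
    mul_le_mul_of_nonneg_right hκD hXpos.le
  have hcpos : 0 < (A * lam ^ β + C + lam) * X :=
    mul_pos (by nlinarith [mul_nonneg hA.le hlamβ]) hXpos
  have : κ * D ^ δ * (D ^ β * g + D * h) = κ * D ^ δ * X := by rw [hX]
  rw [this] at hle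
  nlinarith

/-- The card's critical order `t_crit(D') = K·D^{τ−1−δ}·D'` below which a level-`D'` form with `t`
small jets is not lethal (`lethalOrder` of the ideator's Sketch). -/
def tcrit (K τ δ D D' : ℝ) : ℝ := K * D ^ (τ - 1 - δ) * D'

/-- **Non-novelty certificate for consequence (c).** "`3·D'^τ > t_crit(D')`" (the whole count of
level `D'` is lethal) is, for `D' > 0`, the inequality `D'^{τ−1} > (K/3)·D^{τ−1−δ}` — the shape of
Roy's first endgame inequality `(D*)^{τ−1} ≤ (3/κ) D^{τ−1−δ}` (`Roy2013.endgame_step`.1) read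
contrapositively: the lever re-derives Roy's `D* ≪ D^{1−δ/(τ−1)}`, it moves no exponent.
[cite: Roy2013, §7, Step 5] -/
theorem tcrit_lt_count_iff {K τ δ D D' : ℝ} (hD' : 0 < D') :
    tcrit K τ δ D D' < 3 * D' ^ τ ↔ K / 3 * D ^ (τ - 1 - δ) < D' ^ (τ - 1) := by
  unfold tcrit
  have hsplit : D' ^ τ = D' ^ (τ - 1) * D' := by
    rw [Real.rpow_sub_one hD'.ne']; field_simp
  rw [hsplit]
  constructor
  · intro h
    nlinarith
  · intro h
    nlinarith

/-- Sanity link to the tree: Roy's endgame step is available with exactly this shape. -/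
example := @Roy2013.endgame_step

/-! ## §2 The transfer is degenerate: "in every counterexample, Φ" is the crux plus a free lemma -/

/-- The shape of every counterexample-anatomy transfer: "for every counterexample
`(ξ, η, β, τ, ν)` to the crux (hypothesis holds, conclusion fails), `Φ ξ η β τ ν`". -/
def InEveryCounterexample (Φ : ℂ → ℂ → ℝ → ℝ → ℝ → Prop) : Prop :=
  ∀ (ξ η : ℂ), η ≠ 0 → ∀ (β τ ν : ℝ), 1 ≤ τ → τ < 2 → τ < β → 2 + β - τ < ν →
    SmallValueHyp ξ η β τ ν → ¬ (IsAlgebraic ℚ ξ ∧ IsAlgebraic ℚ η) → Φ ξ η β τ ν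

/-- The crux implies EVERY such transfer (vacuously: under the crux there is no counterexample). -/
theorem inEveryCounterexample_of_crux (Φ : ℂ → ℂ → ℝ → ℝ → ℝ → Prop)
    (h : RoySmallValueDirichletGap) : InEveryCounterexample Φ :=
  fun ξ η hη β τ ν h1 h2 hβ hν hyp hnot => (hnot (h ξ η hη β τ ν h1 h2 hβ hν hyp)).elim

/-- Two transfers whose bodies are jointly contradictory imply the crux. In the card:
`Φ` = non-persistence (BNP), `Ψ` = persistence (the structure lemma (a)+(b)+(d)). -/
theorem crux_of_inEveryCounterexample {Φ Ψ : ℂ → ℂ → ℝ → ℝ → ℝ → Prop}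
    (hΦ : InEveryCounterexample Φ) (hΨ : InEveryCounterexample Ψ)
    (h : ∀ ξ η β τ ν, Φ ξ η β τ ν → Ψ ξ η β τ ν → False) : RoySmallValueDirichletGap := by
  intro ξ η hη β τ ν h1 h2 hβ hν hyp
  by_contra hnot
  exact h ξ η β τ ν (hΦ ξ η hη β τ ν h1 h2 hβ hν hyp hnot) (hΨ ξ η hη β τ ν h1 h2 hβ hν hyp hnot)

/-- The crux is the transfer with body `False`. -/
theorem crux_iff_inEveryCounterexample_false :
    RoySmallValueDirichletGap ↔ InEveryCounterexample fun _ _ _ _ _ => False :=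
  ⟨fun h => inEveryCounterexample_of_crux _ h,
    fun h => crux_of_inEveryCounterexample h h fun _ _ _ _ _ hf _ => hf⟩

/-! ### BNP typed -/

/-- Exact `𝒟₁`-flatness to order `n` of an integer polynomial at an affine point `a = (x, y)`:
`𝒟₁ⁱP(a) = 0` for `i < n` — i.e. `P` restricted to the leaf `{X₂e^{−X₁} = y e^{−x}}` through `a`
vanishes to order `n` at `a`. [cite: Roy2013, §7, Step 3 (`Z ⊂ 𝒵(𝒟ⁱP̃_{D'} : i < 2⌊D'^τ⌋)`)] -/
def FlatAt (P : MvPolynomial (Fin 2) ℤ) (a : Fin 2 → ℂ) (n : ℕ) : Prop :=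
  ∀ i < n, MvPolynomial.aeval a (royD^[i] P) = 0

/-- A hypothesis SEQUENCE: `P D` witnesses the crux hypothesis at every large level `D`. -/
def IsHypSeq (P : ℕ → MvPolynomial (Fin 2) ℤ) (ξ η : ℂ) (β τ ν : ℝ) : Prop :=
  ∀ᶠ D : ℕ in atTop, P D ≠ 0 ∧ (P D).totalDegree ≤ D ∧
    (mvPolyHeight (P D) : ℝ) ≤ Real.exp ((D : ℝ) ^ β) ∧
    ∀ i : ℕ, i < 3 * ⌊(D : ℝ) ^ τ⌋₊ →
      ‖MvPolynomial.aeval ![ξ, η] (royD^[i] (P D))‖ ≤ Real.exp (-(D : ℝ) ^ ν)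

/-- The hypothesis is the existence of a hypothesis sequence (choice, level by level). -/
theorem smallValueHyp_iff_exists_hypSeq {ξ η : ℂ} {β τ ν : ℝ} :
    SmallValueHyp ξ η β τ ν ↔ ∃ P, IsHypSeq P ξ η β τ ν := by
  classical
  constructor
  · intro h
    refine ⟨fun D => if hD : ∃ P : MvPolynomial (Fin 2) ℤ, P ≠ 0 ∧ P.totalDegree ≤ D ∧
        (mvPolyHeight P : ℝ) ≤ Real.exp ((D : ℝ) ^ β) ∧
        ∀ i : ℕ, i < 3 * ⌊(D : ℝ) ^ τ⌋₊ →
          ‖MvPolynomial.aeval ![ξ, η] (royD^[i] P)‖ ≤ Real.exp (-(D : ℝ) ^ ν) then hD.choose else 0, ?_⟩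
    unfold IsHypSeq
    filter_upwards [h] with D hD
    simp only [dif_pos hD]
    exact hD.choose_spec
  · rintro ⟨P, hP⟩
    unfold SmallValueHyp
    filter_upwards [hP] with D hD
    exact ⟨P D, hD⟩

/-- PERSISTENCE of a finite configuration `S` of affine points over the level window `[D/Λ, ΛD]`:
at every level `D'` of the window, every point of `S` is a `2⌊D'^τ⌋`-fold leaf-zero of `P D'`
(`S ⊂ W_{D'}` in Roy's notation). [cite: Roy2013, §7, Step 3] -/
def PersistsOn (P : ℕ → MvPolynomial (Fin 2) ℤ) (τ : ℝ) (S : Finset (Fin 2 → ℂ)) (Λ : ℝ) (D : ℕ) :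
    Prop :=
  ∀ D' : ℕ, (D : ℝ) / Λ ≤ D' → (D' : ℝ) ≤ Λ * D → ∀ a ∈ S, FlatAt (P D') a (2 * ⌊(D' : ℝ) ^ τ⌋₊)

/-- The card's transfer **BNP(Λ)** ("bounded-width non-persistence"): in every counterexample, for
every hypothesis sequence and every large `D`, NO configuration `S` qualifying as Roy's level-`D`
enemy (Step-2 inequality; left ABSTRACT as `Qual` — the degeneracy below holds for any `Qual`)
persists over `[D/Λ, ΛD]`. -/
def BNP (Qual : (ℕ → MvPolynomial (Fin 2) ℤ) → ℂ → ℂ → ℝ → ℝ → ℝ → ℕ → Finset (Fin 2 → ℂ) → Prop)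
    (Λ : ℝ) : Prop :=
  InEveryCounterexample fun ξ η β τ ν =>
    ∀ P, IsHypSeq P ξ η β τ ν → ∀ᶠ D : ℕ in atTop, ∀ S, Qual P ξ η β τ ν D S → ¬ PersistsOn P τ S Λ D

/-- The card's own structure lemma ((a) upward containment + (b) absorption + (d) window; TRUE by
§1 + Roy's Steps 1–3, size M modulo the per-level data refactor): in every counterexample some
hypothesis sequence has, at every large level `D`, a qualifying enemy that DOES persist over
`[D/Λ, ΛD]` (for `Λ` below the card's `Λ(β, τ, 25, 8)`, once `D^δ ≫ 1`). -/
def PersistenceLemma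
    (Qual : (ℕ → MvPolynomial (Fin 2) ℤ) → ℂ → ℂ → ℝ → ℝ → ℝ → ℕ → Finset (Fin 2 → ℂ) → Prop)
    (Λ : ℝ) : Prop :=
  InEveryCounterexample fun ξ η β τ ν =>
    ∃ P, IsHypSeq P ξ η β τ ν ∧ ∀ᶠ D : ℕ in atTop, ∃ S, Qual P ξ η β τ ν D S ∧ PersistsOn P τ S Λ D

/-- `crux ⇒ BNP` (vacuous). -/
theorem bnp_of_crux (Qual) (Λ : ℝ) (h : RoySmallValueDirichletGap) : BNP Qual Λ :=
  inEveryCounterexample_of_crux _ h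

/-- `Persistence ⇒ BNP ⇒ crux`: given the (true, free) structure lemma, BNP is EQUIVALENT to the
crux — the transfer is the crux restricted to a class that contains every counterexample
(COSTUME; r2-1/r2-2 "crux + free lemma", r2-3 "costume transfer"). -/
theorem crux_of_bnp {Qual} {Λ : ℝ} (hP : PersistenceLemma Qual Λ) (hB : BNP Qual Λ) :
    RoySmallValueDirichletGap := by
  refine crux_of_inEveryCounterexample hB hP fun ξ η β τ ν hΦ hΨ => ?_
  obtain ⟨P, hPseq, hpers⟩ := hΨ
  have hnon := hΦ P hPseq
  obtain ⟨D, hD1, S, hQ, hS⟩ := (hnon.and hpers).exists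
  exact hD1 S hQ hS

/-! ## §3 The landed Negative lemmas this file is checked against (imports elaborate) -/

example := @Summit.Schanuel.Schanuel.Theorems.RoySmallValueDirichletGapGap.roySmallValueDirichletGap_iff_gap
example := @Summit.Schanuel.Schanuel.Theorems.RoySmallValueDirichletGapGap.roySmallValueDirichletGap_iff_nearEdge
example := @Summit.Schanuel.Schanuel.Theorems.roySmallValueDirichletGap_false_without_etaNeZero
example := @Summit.Schanuel.Schanuel.Theorems.RoySmallValueDirichletGapTauCount.roySmallValueDirichletGap_false_without_oneLeTau
example := @Summit.Schanuel.Schanuel.Theorems.RoySmallValueDirichletGapTauCount.roySmallValueDirichletGap_false_of_count_le_degree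
example := @Summit.Schanuel.Schanuel.Theorems.RoySmallValueDirichletGapDirichlet.roySmallValueDirichletGap_false_of_edge_lowered
example := @Summit.Schanuel.Schanuel.Theorems.RoySmallValueDirichletGapFrequently.roySmallValueDirichletGap_false_with_frequently

end Summit.Schanuel.Schanuel.Cruxes.RoySmallValueDirichletGap.UpwardLethalityPersistence

end
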